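import Summits.Ventures.CertifiedManyBodySolver.Rows.HalfFilledTLTorus
import Literature.MathematicalPhysics.QuantumLattice.HubbardRingGroundStateContinuityProofs
import Literature.MathematicalPhysics.QuantumLattice.GroundStateEnclosureCertificate
import Literature.MathematicalPhysics.QuantumLattice.SectorGroundProjContinuity
import Literature.MathematicalPhysics.QuantumLattice.SectorGroundStateContinuity

/-!
# M2 rows, part 7: symmetry-block pins for finite-torus enclosures (`T4_E` Kato–Temple rows)

HONEST FRAMING (speedrun cell `mbsolver`, M2): first certified bounds; not a superconductivity
verdict; every number certified or labelled float.  This file contains NO numbers.  It types the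
hypothesis structure of the ENCLOSURE-derived finite-torus rows of the M2 table (`HOME/m2/M2-TABLE`
block `enclosures`; `TL-STATEMENT.md` §9.8): a Kato–Temple enclosure of the lowest eigenvalue of
`H(U) = hamiltonian (fermionTorusGraph 2 L) 1 U` COMPRESSED TO A SYMMETRY BLOCK `K` (a lattice-symmetry
character block of the central sector `szSector (L²) 0`) is an enclosure of the half-filled ground-state
energy `E₀(L×L, N = L²)` exactly when the block is PINNED:

`M2.TorusBlockPinRow L U K : minEnergyOn (H U) K = E₀(L×L, t = 1, U, N = L²)`.

## §1 What a block gives without a pin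
For any nonzero `H`-invariant block `K` of `L²`-particle states, `E₀ ≤ minEnergyOn (H U) K`
(`groundEnergyAt_le_minEnergyOn`), so the UPPER endpoint of a block enclosure is unconditional
(`TorusEnergyUpperRow.of_block_templeKato`); only the LOWER endpoint needs the pin
(`TorusEnergyLowerRow.of_blockPin`, `TorusEnergyLowerRow.of_blockPin_templeKato`, whose remaining
hypotheses are literally those of `TempleKato.sector_enclosure_of_sums`: a form floor `σ` on a subspace
`W` with `K ≤ W + ℂu` — the positive-definite gap certificate and the frame/completeness claim — and the
exact Rayleigh sums `N, ρN, (r² + ρ²)N` of an integer trial vector `w ∈ K`).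

## §2 Two solver-free sources of a pin
* EXCLUSION (`TorusBlockPinRow.of_exclusion`, `…of_exclusion_upperRow`): on an even torus with `U > 0`
  (Lieb: THE ground state `ψ` exists, is unique and lies in `szSector (L²) 0`), if the central sector is
  covered by `K` and an orthogonal `H`-invariant block `K'` on which the form of `H` is `≥ τ‖·‖²` with
  `E₀ < τ` (e.g. `E₀ ≤ hi < τ` from a trial-state ceiling), then `ψ ∈ K` and the block is pinned.  Floors
  on several orthogonal invariant blocks combine (`blockFloor_sup`), so the complementary characters may
  be certified one block at a time.
* CONTINUATION IN `U` (`TorusBlockPinRow.propagate`): if `K ≤ szSector (L²) 0` is nonzero and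
  `H(U)`-invariant for every `U > 0`, a pin at ONE coupling `U₀ > 0` is a pin at EVERY `U > 0`.  This is
  the tree's Lieb–Wu continuation lemma `eigenvalue_eq_minEnergyOn_szSector` (the coincidence set of the
  continuous block minimum with the simple — by Lieb's theorem — sector minimum is open and closed in
  `(0, ∞)`), with the Lipschitz continuity of block minima (`EigenvalueContinuation.abs_sectorMin_sub_le`,
  `abs_re_expect_hamiltonian_sub_le`).  Consequently per-`U` pin certificates are redundancy, not extra
  hypotheses.

Nothing is specific to `L = 4`: blocks, floors, frames and sums are certificate-supplied hypotheses (the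
table's `[X]`/`[F]` claim nodes); Lieb's theorem, Kato–Temple and the continuation lemma are tree theorems.
References: Lieb, PRL 62 (1989) 1201, Thm 2; Lieb–Wu, Physica A 321 (2003) 1, §2; Saad (1992) Ch. III
Thm 3.8–3.9 (Kato–Temple); Tasaki (2020) §2.1–2.2.
-/

noncomputable section

namespace Summit.Ventures.CertifiedManyBodySolver
open Literature.MathematicalPhysics.QuantumLattice
open Matrix HubbardWave0 Literature.Probability.LatticeModels EigenvalueContinuation

namespace M2

/-! ## §0 The row -/

/-- **Block pin row**: the lowest energy of `H(U) = hamiltonian (fermionTorusGraph 2 L) 1 U` on the block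
`K` is the half-filled ground-state energy `E₀(L × L, t = 1, U, N = L²)`.
[cite: LiebPRL1989, Theorem 2] [cite: LiebWuPhysicaA2003, §2] -/
def TorusBlockPinRow (L : ℕ) (U : ℝ) (K : Submodule ℂ (Fock (Orb (FermionTorus 2 L)))) : Prop :=
  (hamiltonian (fermionTorusGraph 2 L) 1 U).minEnergyOn K = groundEnergyAt (fermionTorusGraph 2 L) 1 U (L ^ 2)

/-! ## §1 Blocks without a pin: the variational half -/

section Generic

variable {Λ : Type*} [LinearOrder Λ] [Fintype Λ] (G : SimpleGraph Λ) [DecidableRel G.Adj]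

/-- **A block minimum is an `N`-particle energy**: for a nonzero `H`-invariant block `K` of `N`-particle
states, `E₀(N) ≤ minEnergyOn H K` (the block minimum is attained at a unit eigenvector in `K`, which is an
`N`-particle trial state). [cite: Tasaki2020, §2.1] -/
theorem groundEnergyAt_le_minEnergyOn (t U : ℝ) {N : ℕ} {K : Submodule ℂ (Fock (Orb Λ))}
    (hKN : K ≤ nParticleSubmodule N) (hKH : ∀ v ∈ K, hamiltonian G t U *ᵥ v ∈ K) (hK : K ≠ ⊥) :
    groundEnergyAt G t U N ≤ (hamiltonian G t U).minEnergyOn K := by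
  obtain ⟨ψ, hψK, hψ1, hHψ⟩ :=
    exists_unit_eigen_minEnergyOn (LiebThm1.hamiltonian_isHermitian G t U) K hKH hK
  have hN : IsNParticle N ψ := (mem_nParticleSubmodule_iff N ψ).1 (hKN hψK)
  have h := LiebThm1.groundEnergy_le_re_expect (hamiltonian G t U) hN hψ1
  rw [expect, hHψ, dotProduct_smul, hψ1, smul_eq_mul, mul_one, Complex.ofReal_re] at h
  exact h

/-- **An eigenvector in the block bounds the block minimum**: `φ ∈ K`, `φ ≠ 0`, `H φ = E φ` give
`minEnergyOn H K ≤ E` (variational principle in the block). [cite: Tasaki2020, §2.2] -/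
theorem minEnergyOn_le_of_eigen_mem (t U : ℝ) (K : Submodule ℂ (Fock (Orb Λ))) {φ : Fock (Orb Λ)}
    (hφK : φ ∈ K) (hφ0 : φ ≠ 0) {E : ℝ} (hHφ : hamiltonian G t U *ᵥ φ = (E : ℂ) • φ) :
    (hamiltonian G t U).minEnergyOn K ≤ E := by
  have h := minEnergyOn_mul_le_re_rayleigh (LiebThm1.hamiltonian_isHermitian G t U) K hφK
  rw [hHφ, dotProduct_smul, smul_eq_mul, Complex.re_ofReal_mul] at h
  exact le_of_mul_le_mul_right h (re_star_dotProduct_self_pos hφ0)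

/-- **Orthogonal invariant blocks do not talk through `H`**: if `H K' ≤ K'` and `K ⊥ K'` then
`⟨z, H y⟩ = 0` for `z ∈ K'`, `y ∈ K` (Hermiticity). [folklore] -/
theorem star_dotProduct_hamiltonian_mulVec_eq_zero (t U : ℝ) {K K' : Submodule ℂ (Fock (Orb Λ))}
    (hK'H : ∀ v ∈ K', hamiltonian G t U *ᵥ v ∈ K')
    (horth : ∀ y ∈ K, ∀ z ∈ K', star y ⬝ᵥ z = 0) {y z : Fock (Orb Λ)} (hy : y ∈ K) (hz : z ∈ K') :
    star z ⬝ᵥ hamiltonian G t U *ᵥ y = 0 := by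
  rw [star_dotProduct_mulVec_comm (LiebThm1.hamiltonian_isHermitian G t U).eq, horth y hy _ (hK'H z hz),
    star_zero]

/-- **Floors on orthogonal invariant blocks combine**: if the form of `H` is `≥ τ ‖·‖²` on `K₂` and on
`K₃`, both `H`-invariant and mutually orthogonal, it is `≥ τ ‖·‖²` on `K₂ ⊔ K₃` (cross terms vanish).
So complementary symmetry characters may be certified one block at a time. [folklore] -/
theorem blockFloor_sup (t U : ℝ) {K₂ K₃ : Submodule ℂ (Fock (Orb Λ))} {τ : ℝ}
    (h₂H : ∀ v ∈ K₂, hamiltonian G t U *ᵥ v ∈ K₂) (h₃H : ∀ v ∈ K₃, hamiltonian G t U *ᵥ v ∈ K₃)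
    (horth : ∀ a ∈ K₂, ∀ b ∈ K₃, star a ⬝ᵥ b = 0)
    (h₂ : ∀ z ∈ K₂, τ * (star z ⬝ᵥ z).re ≤ (star z ⬝ᵥ hamiltonian G t U *ᵥ z).re)
    (h₃ : ∀ z ∈ K₃, τ * (star z ⬝ᵥ z).re ≤ (star z ⬝ᵥ hamiltonian G t U *ᵥ z).re) :
    ∀ z ∈ K₂ ⊔ K₃, τ * (star z ⬝ᵥ z).re ≤ (star z ⬝ᵥ hamiltonian G t U *ᵥ z).re := by
  intro z hz
  obtain ⟨a, ha, b, hb, rfl⟩ := Submodule.mem_sup.1 hz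
  have hab : star a ⬝ᵥ b = 0 := horth a ha b hb
  have hba : star b ⬝ᵥ a = 0 := by
    rw [← star_star (star b ⬝ᵥ a), star_dotProduct, star_star, hab, star_zero]
  have hHab : star b ⬝ᵥ hamiltonian G t U *ᵥ a = 0 :=
    star_dotProduct_hamiltonian_mulVec_eq_zero G t U h₃H horth ha hb
  have hHba : star a ⬝ᵥ hamiltonian G t U *ᵥ b = 0 :=
    star_dotProduct_hamiltonian_mulVec_eq_zero G t U h₂H (fun x hx y hy => by
      rw [← star_star (star x ⬝ᵥ y), star_dotProduct, star_star, horth y hy x hx, star_zero]) hb ha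
  have hnorm : (star (a + b) ⬝ᵥ (a + b)).re = (star a ⬝ᵥ a).re + (star b ⬝ᵥ b).re := by
    rw [star_add, add_dotProduct, dotProduct_add, dotProduct_add, hab, hba]
    simp
  have hform : (star (a + b) ⬝ᵥ hamiltonian G t U *ᵥ (a + b)).re =
      (star a ⬝ᵥ hamiltonian G t U *ᵥ a).re + (star b ⬝ᵥ hamiltonian G t U *ᵥ b).re := by
    rw [mulVec_add, star_add, add_dotProduct, dotProduct_add, dotProduct_add, hHba, hHab]
    simp
  rw [hnorm, hform, mul_add]
  exact add_le_add (h₂ a ha) (h₃ b hb)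

end Generic

/-! ## §2 Pins -/

variable {L : ℕ}

/-- **A ground state in the block pins it**: if some `L²`-particle ground state of the `L × L` torus lies
in the `H`-invariant block `K` of `L²`-particle states, then `minEnergyOn (H U) K = E₀(L²)`.
[cite: Tasaki2020, §2.1] -/
theorem TorusBlockPinRow.of_groundState_mem {U : ℝ} {K : Submodule ℂ (Fock (Orb (FermionTorus 2 L)))}
    (hKN : K ≤ nParticleSubmodule (L ^ 2))
    (hKH : ∀ v ∈ K, hamiltonian (fermionTorusGraph 2 L) 1 U *ᵥ v ∈ K)
    {ψ : Fock (Orb (FermionTorus 2 L))}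
    (hψ : IsGroundState (hamiltonian (fermionTorusGraph 2 L) 1 U) (L ^ 2) ψ) (hψK : ψ ∈ K) :
    TorusBlockPinRow L U K := by
  obtain ⟨-, hψ0, hHψ⟩ := hψ
  have hK : K ≠ ⊥ := fun h => hψ0 ((Submodule.mem_bot ℂ).1 (h ▸ hψK))
  refine le_antisymm ?_ (groundEnergyAt_le_minEnergyOn (fermionTorusGraph 2 L) 1 U hKN hKH hK)
  exact minEnergyOn_le_of_eigen_mem (fermionTorusGraph 2 L) 1 U K hψK hψ0 hHψ

/-- **Pin by exclusion** (even torus, `U > 0`).  Let `K, K'` be blocks with `K` made of `L²`-particle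
states and `H`-invariant, `K'` `H`-invariant and orthogonal to `K`, together covering the central sector
`szSector (L²) 0 ≤ K ⊔ K'`; if the form of `H` on `K'` is `≥ τ ‖·‖²` with `E₀(L²) < τ`, then THE ground
state (Lieb) lies in `K` and `minEnergyOn (H U) K = E₀(L²)`.  (`K'` may be assembled from several
orthogonal invariant blocks by `blockFloor_sup`.) [cite: LiebPRL1989, Theorem 2] -/
theorem TorusBlockPinRow.of_exclusion [NeZero L] (hL : Even L) {U : ℝ} (hU : 0 < U)
    {K K' : Submodule ℂ (Fock (Orb (FermionTorus 2 L)))}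
    (hKN : K ≤ nParticleSubmodule (L ^ 2))
    (hKH : ∀ v ∈ K, hamiltonian (fermionTorusGraph 2 L) 1 U *ᵥ v ∈ K)
    (hK'H : ∀ v ∈ K', hamiltonian (fermionTorusGraph 2 L) 1 U *ᵥ v ∈ K')
    (horth : ∀ y ∈ K, ∀ z ∈ K', star y ⬝ᵥ z = 0)
    (hcover : szSector (Λ := FermionTorus 2 L) (L ^ 2) 0 ≤ K ⊔ K')
    {τ : ℝ} (hfloor : ∀ z ∈ K', τ * (star z ⬝ᵥ z).re ≤ (star z ⬝ᵥ hamiltonian (fermionTorusGraph 2 L) 1 U *ᵥ z).re)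
    (hτ : groundEnergyAt (fermionTorusGraph 2 L) 1 U (L ^ 2) < τ) :
    TorusBlockPinRow L U K := by
  set H := hamiltonian (fermionTorusGraph 2 L) 1 U with hH
  set E₀ : ℝ := groundEnergyAt (fermionTorusGraph 2 L) 1 U (L ^ 2) with hE₀
  obtain ⟨ψ, hψS, hψ1, hHψ, -⟩ :=
    LiebHalfFilled.hubbardTorus_exists_unit_groundState_pow (d := 2) (L := L) two_pos hL one_ne_zero hU
  have hψN : IsNParticle (L ^ 2) ψ := ((mem_szSector_iff _ _ _).1 hψS).1
  have hψ0 : ψ ≠ 0 := by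
    rintro rfl
    rw [star_zero, zero_dotProduct] at hψ1
    exact zero_ne_one hψ1
  -- decompose THE ground state along `K ⊔ K'`
  obtain ⟨y, hy, z, hz, hyz⟩ := Submodule.mem_sup.1 (hcover hψS)
  -- `⟨z, H ψ⟩ = ⟨z, H z⟩` and `⟨z, ψ⟩ = ⟨z, z⟩`
  have hzy : star z ⬝ᵥ y = 0 := by
    rw [← star_star (star z ⬝ᵥ y), star_dotProduct, star_star, horth y hy z hz, star_zero]
  have hzHy : star z ⬝ᵥ H *ᵥ y = 0 :=
    star_dotProduct_hamiltonian_mulVec_eq_zero (fermionTorusGraph 2 L) 1 U hK'H horth hy hz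
  have hzz : star z ⬝ᵥ H *ᵥ z = (E₀ : ℂ) * (star z ⬝ᵥ z) := by
    have h1 : star z ⬝ᵥ H *ᵥ ψ = (E₀ : ℂ) * (star z ⬝ᵥ ψ) := by
      rw [hHψ, dotProduct_smul, smul_eq_mul]
    rw [← hyz, mulVec_add, dotProduct_add, dotProduct_add, hzHy, hzy, zero_add, zero_add] at h1
    exact h1
  -- hence `z = 0`
  have hz0 : z = 0 := by
    by_contra hz0
    have hpos := re_star_dotProduct_self_pos hz0
    have hf := hfloor z hz
    rw [hzz, Complex.re_ofReal_mul] at hf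
    have : τ ≤ E₀ := le_of_mul_le_mul_right hf hpos
    exact absurd hτ (not_lt.2 this)
  rw [hz0, add_zero] at hyz
  rw [← hyz] at hψN hψ0 hHψ
  exact TorusBlockPinRow.of_groundState_mem hKN hKH ⟨hψN, hψ0, hHψ⟩ hy

/-- **Pin by exclusion, table form**: as `of_exclusion`, with `E₀(L²) < τ` discharged by a certified
ceiling `T{L}_E.hi` (`TorusEnergyUpperRow L U hi`, e.g. `TorusEnergyUpperRow.of_trial`) and the rational
comparison `hi < τ`. [cite: LiebPRL1989, Theorem 2] -/
theorem TorusBlockPinRow.of_exclusion_upperRow [NeZero L] (hL : Even L) {U : ℝ} (hU : 0 < U)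
    {K K' : Submodule ℂ (Fock (Orb (FermionTorus 2 L)))}
    (hKN : K ≤ nParticleSubmodule (L ^ 2))
    (hKH : ∀ v ∈ K, hamiltonian (fermionTorusGraph 2 L) 1 U *ᵥ v ∈ K)
    (hK'H : ∀ v ∈ K', hamiltonian (fermionTorusGraph 2 L) 1 U *ᵥ v ∈ K')
    (horth : ∀ y ∈ K, ∀ z ∈ K', star y ⬝ᵥ z = 0)
    (hcover : szSector (Λ := FermionTorus 2 L) (L ^ 2) 0 ≤ K ⊔ K')
    {τ : ℚ} (hfloor : ∀ z ∈ K', ((τ : ℚ) : ℝ) * (star z ⬝ᵥ z).re ≤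
      (star z ⬝ᵥ hamiltonian (fermionTorusGraph 2 L) 1 U *ᵥ z).re)
    {hi : ℚ} (hup : TorusEnergyUpperRow L U hi) (hτ : hi < τ) :
    TorusBlockPinRow L U K :=
  TorusBlockPinRow.of_exclusion hL hU hKN hKH hK'H horth hcover hfloor
    (lt_of_le_of_lt hup (by exact_mod_cast hτ))

/-- **A pin at one coupling is a pin at every coupling** (Lieb–Wu continuation on the even torus).  Let
`K ≤ szSector (L²) 0` be a nonzero block invariant under `H(U)` for every `U > 0`.  The block minimum
`U ↦ minEnergyOn (H U) K` is continuous (Lipschitz) and is, for each `U`, an eigenvalue of `H(U)` with an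
eigenvector in the central sector, whose ground state is simple for every `U > 0` (Lieb); so if it equals
`E₀(L²)` at one `U₀ > 0` it equals `E₀(L²)` on all of `(0, ∞)` (`eigenvalue_eq_minEnergyOn_szSector`).
[cite: LiebWuPhysicaA2003, §2] [cite: LiebPRL1989, Theorem 2] -/
theorem TorusBlockPinRow.propagate [NeZero L] (hL : Even L)
    {K : Submodule ℂ (Fock (Orb (FermionTorus 2 L)))}
    (hKS : K ≤ szSector (Λ := FermionTorus 2 L) (L ^ 2) 0) (hK : K ≠ ⊥)
    (hKH : ∀ U : ℝ, 0 < U → ∀ v ∈ K, hamiltonian (fermionTorusGraph 2 L) 1 U *ᵥ v ∈ K)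
    {U₀ : ℝ} (hU₀ : 0 < U₀) (h₀ : TorusBlockPinRow L U₀ K) {U : ℝ} (hU : 0 < U) :
    TorusBlockPinRow L U K := by
  -- half filling: `L² = 2n`
  obtain ⟨n, hΛ⟩ : ∃ n : ℕ, L ^ 2 = 2 * n := by
    obtain ⟨m, hm⟩ := hL
    exact ⟨2 * m ^ 2, by subst hm; ring⟩
  have hcardΛ : Fintype.card (FermionTorus 2 L) = L ^ 2 := by
    simp only [FermionTorus, Fintype.card_lex, Fintype.card_fun, Fintype.card_fin]
  have hn : n ≤ Fintype.card (FermionTorus 2 L) := by rw [hcardΛ]; omega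
  unfold TorusBlockPinRow at h₀ ⊢
  rw [hΛ] at hKS h₀ ⊢
  set G := fermionTorusGraph 2 L with hG
  set S : Set ℝ := Set.Ioi 0 with hS
  set E : ℝ → ℝ := fun u => (hamiltonian G 1 u).minEnergyOn K with hE
  have hHerm : ∀ u : ℝ, (hamiltonian G 1 u).IsHermitian := fun u => LiebThm1.hamiltonian_isHermitian G 1 u
  -- block ground states exist (block minimum attained at a unit eigenvector of `K`)
  have hgs : ∀ u ∈ S, ∃ ψ ∈ K, star ψ ⬝ᵥ ψ = 1 ∧ hamiltonian G 1 u *ᵥ ψ = (E u : ℂ) • ψ :=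
    fun u hu => exists_unit_eigen_minEnergyOn (hHerm u) K (hKH u hu) hK
  -- the block minimum is `|Λ|`-Lipschitz, hence continuous, on `S`
  have hlipE : ∀ u ∈ S, ∀ u' ∈ S, |E u - E u'| ≤ (Fintype.card (FermionTorus 2 L) : ℝ) * |u - u'| :=
    abs_sectorMin_sub_le K (fun u => hamiltonian G 1 u) E S
      (fun u _ u' _ v _ => abs_re_expect_hamiltonian_sub_le G 1 u u' v)
      (fun u _ v hv => minEnergyOn_mul_le_re_rayleigh (hHerm u) K hv) hgs
  have hcont : ContinuousOn E S := by
    rw [Metric.continuousOn_iff]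
    intro b hb ε hε
    refine ⟨ε / ((Fintype.card (FermionTorus 2 L) : ℝ) + 1), by positivity, fun a ha hab => ?_⟩
    rw [Real.dist_eq] at hab ⊢
    have hc0 : (0 : ℝ) ≤ (Fintype.card (FermionTorus 2 L) : ℝ) := Nat.cast_nonneg _
    have h1 := hlipE a ha b hb
    have h2 : (Fintype.card (FermionTorus 2 L) : ℝ) * |a - b| ≤
        ((Fintype.card (FermionTorus 2 L) : ℝ) + 1) * |a - b| :=
      mul_le_mul_of_nonneg_right (by linarith) (abs_nonneg _)
    have h3 : ((Fintype.card (FermionTorus 2 L) : ℝ) + 1) * |a - b| <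
        ((Fintype.card (FermionTorus 2 L) : ℝ) + 1) * (ε / ((Fintype.card (FermionTorus 2 L) : ℝ) + 1)) :=
      mul_lt_mul_of_pos_left hab (by linarith)
    rw [mul_div_cancel₀ _ (by linarith : ((Fintype.card (FermionTorus 2 L) : ℝ) + 1) ≠ 0)] at h3
    linarith
  -- Lieb: the central-sector ground state is simple for every `U > 0`
  have huniq : ∀ u ∈ S, ∀ ψ₁ ψ₂, IsGroundStateInSector (hamiltonian G 1 u) (2 * n) 0 ψ₁ →
      IsGroundStateInSector (hamiltonian G 1 u) (2 * n) 0 ψ₂ → ∃ c : ℂ, ψ₂ = c • ψ₁ := by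
    intro u hu ψ₁ ψ₂ h₁ h₂
    obtain ⟨ψ, -, -, -, huniqN, -⟩ :=
      LiebHalfFilled.hubbardTorus_exists_unit_groundState_pow (d := 2) (L := L) two_pos hL one_ne_zero hu
    rw [hΛ, groundEnergyAt_eq_minEnergyOn_szSector G 1 u hn] at huniqN
    obtain ⟨hψ₁S, hψ₁0, hHψ₁⟩ := h₁
    obtain ⟨hψ₂S, -, hHψ₂⟩ := h₂
    have e₁ := huniqN ψ₁ ((mem_szSector_iff _ _ _).1 hψ₁S).1 hHψ₁
    have e₂ := huniqN ψ₂ ((mem_szSector_iff _ _ _).1 hψ₂S).1 hHψ₂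
    set c₁ : ℂ := star ψ ⬝ᵥ ψ₁ with hc₁
    set c₂ : ℂ := star ψ ⬝ᵥ ψ₂ with hc₂
    have hc₁0 : c₁ ≠ 0 := by
      intro h0
      rw [h0, zero_smul] at e₁
      exact hψ₁0 e₁
    refine ⟨c₂ * c₁⁻¹, ?_⟩
    rw [e₂, e₁, smul_smul, mul_assoc, inv_mul_cancel₀ hc₁0, mul_one]
  -- the block minimum is an eigenvalue with an eigenvector in the central sector
  have hev : ∀ u ∈ S, ∃ φ ∈ szSector (Λ := FermionTorus 2 L) (2 * n) 0, φ ≠ 0 ∧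
      hamiltonian G 1 u *ᵥ φ = (E u : ℂ) • φ := by
    intro u hu
    obtain ⟨ψ, hψK, hψ1, hHψ⟩ := hgs u hu
    refine ⟨ψ, hKS hψK, ?_, hHψ⟩
    rintro rfl
    rw [star_zero, zero_dotProduct] at hψ1
    exact zero_ne_one hψ1
  -- the pin at `U₀`, read in the central sector
  have h0' : E U₀ = (hamiltonian G 1 U₀).minEnergyOn (szSector (2 * n) 0) := by
    rw [← groundEnergyAt_eq_minEnergyOn_szSector G 1 U₀ hn]; exact h₀
  have key := eigenvalue_eq_minEnergyOn_szSector G 1 hn isPreconnected_Ioi huniq hcont hev hU₀ h0' U hU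
  rw [groundEnergyAt_eq_minEnergyOn_szSector G 1 U hn]
  exact key

/-! ## §3 Enclosure rows from a pinned block -/

/-- **Block floor ⟹ `T{L}_E.lo` under a pin**: `lo ≤ minEnergyOn (H U) K` and `TorusBlockPinRow L U K`
give `TorusEnergyLowerRow L U lo`. [cite: LiebPRL1989, Theorem 2] -/
theorem TorusEnergyLowerRow.of_blockPin {U : ℝ} {K : Submodule ℂ (Fock (Orb (FermionTorus 2 L)))}
    (hpin : TorusBlockPinRow L U K) {lo : ℚ}
    (h : ((lo : ℚ) : ℝ) ≤ (hamiltonian (fermionTorusGraph 2 L) 1 U).minEnergyOn K) :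
    TorusEnergyLowerRow L U lo := by
  unfold TorusEnergyLowerRow
  rw [← hpin]
  exact h

/-- **Block ceiling ⟹ `T{L}_E.hi`, NO pin needed**: for a nonzero `H`-invariant block `K` of
`L²`-particle states, `minEnergyOn (H U) K ≤ hi` gives `TorusEnergyUpperRow L U hi`
(`E₀ ≤ minEnergyOn (H U) K`). [cite: Tasaki2020, §2.1] -/
theorem TorusEnergyUpperRow.of_block {U : ℝ} {K : Submodule ℂ (Fock (Orb (FermionTorus 2 L)))}
    (hKN : K ≤ nParticleSubmodule (L ^ 2))
    (hKH : ∀ v ∈ K, hamiltonian (fermionTorusGraph 2 L) 1 U *ᵥ v ∈ K) (hK : K ≠ ⊥) {hi : ℚ}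
    (h : (hamiltonian (fermionTorusGraph 2 L) 1 U).minEnergyOn K ≤ ((hi : ℚ) : ℝ)) :
    TorusEnergyUpperRow L U hi :=
  (groundEnergyAt_le_minEnergyOn (fermionTorusGraph 2 L) 1 U hKN hKH hK).trans h

/-- **Kato–Temple in a pinned block ⟹ `T{L}_E.lo`** — the typed reading of an enclosure-derived floor.
Hypotheses, by name: the pin (`TorusBlockPinRow L U K`, from `of_exclusion` / `propagate`); invariance of
`K`; a form floor `σ` on a subspace `W` (the positive-definite GAP CERTIFICATE, e.g.
`TempleKato.frame_form_ge_of_ldl_certificate`) with `K ≤ W + ℂu` (the FRAME / completeness claim); an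
integer trial vector `w ∈ K` with exact sums `⟨w, w⟩ = N > 0`, `⟨w, H w⟩ = ρN`, `⟨Hw, Hw⟩ ≤ (r² + ρ²)N`
and `ρ < σ` (the exact RAYLEIGH data); and the rational comparison `lo ≤ ρ − r²/(σ − ρ)`.
[cite: Saad1992, Ch. III §3.2 Thm 3.8–3.9] [cite: LiebPRL1989, Theorem 2] -/
theorem TorusEnergyLowerRow.of_blockPin_templeKato {U : ℝ} {K : Submodule ℂ (Fock (Orb (FermionTorus 2 L)))}
    (hpin : TorusBlockPinRow L U K)
    (hKH : ∀ v ∈ K, hamiltonian (fermionTorusGraph 2 L) 1 U *ᵥ v ∈ K)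
    {W : Submodule ℂ (Fock (Orb (FermionTorus 2 L)))} {u : Fock (Orb (FermionTorus 2 L))} {σ : ℝ}
    (hW : ∀ z ∈ W, σ * (star z ⬝ᵥ z).re ≤ (star z ⬝ᵥ hamiltonian (fermionTorusGraph 2 L) 1 U *ᵥ z).re)
    (hWK : ∀ x ∈ K, ∃ z ∈ W, ∃ c : ℂ, x = z + c • u)
    {w : Fock (Orb (FermionTorus 2 L))} (hwK : w ∈ K) {N ρ r2 : ℝ} (hN : 0 < N)
    (hwN : (star w ⬝ᵥ w).re = N)
    (hρ : (star w ⬝ᵥ hamiltonian (fermionTorusGraph 2 L) 1 U *ᵥ w).re = ρ * N)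
    (hr2 : (star (hamiltonian (fermionTorusGraph 2 L) 1 U *ᵥ w) ⬝ᵥ
      hamiltonian (fermionTorusGraph 2 L) 1 U *ᵥ w).re ≤ (r2 + ρ ^ 2) * N)
    (hρσ : ρ < σ) {lo : ℚ} (hlo : ((lo : ℚ) : ℝ) ≤ ρ - r2 / (σ - ρ)) :
    TorusEnergyLowerRow L U lo :=
  TorusEnergyLowerRow.of_blockPin hpin (hlo.trans
    (TempleKato.sector_enclosure_of_sums (LiebThm1.hamiltonian_isHermitian _ 1 U) K hKH hW hWK hwK hN
      hwN hρ hr2 hρσ).1)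

/-- **Kato–Temple in ANY invariant block ⟹ `T{L}_E.hi`** (no pin: the trial vector's Rayleigh quotient
`ρ` bounds `minEnergyOn (H U) K ≥ E₀`), with `hi ≥ ρ`. [cite: Saad1992, Ch. III §3.2 Thm 3.8–3.9]
[cite: Tasaki2020, §2.1] -/
theorem TorusEnergyUpperRow.of_block_templeKato {U : ℝ} {K : Submodule ℂ (Fock (Orb (FermionTorus 2 L)))}
    (hKN : K ≤ nParticleSubmodule (L ^ 2))
    (hKH : ∀ v ∈ K, hamiltonian (fermionTorusGraph 2 L) 1 U *ᵥ v ∈ K)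
    {W : Submodule ℂ (Fock (Orb (FermionTorus 2 L)))} {u : Fock (Orb (FermionTorus 2 L))} {σ : ℝ}
    (hW : ∀ z ∈ W, σ * (star z ⬝ᵥ z).re ≤ (star z ⬝ᵥ hamiltonian (fermionTorusGraph 2 L) 1 U *ᵥ z).re)
    (hWK : ∀ x ∈ K, ∃ z ∈ W, ∃ c : ℂ, x = z + c • u)
    {w : Fock (Orb (FermionTorus 2 L))} (hwK : w ∈ K) {N ρ r2 : ℝ} (hN : 0 < N)
    (hwN : (star w ⬝ᵥ w).re = N)
    (hρ : (star w ⬝ᵥ hamiltonian (fermionTorusGraph 2 L) 1 U *ᵥ w).re = ρ * N)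
    (hr2 : (star (hamiltonian (fermionTorusGraph 2 L) 1 U *ᵥ w) ⬝ᵥ
      hamiltonian (fermionTorusGraph 2 L) 1 U *ᵥ w).re ≤ (r2 + ρ ^ 2) * N)
    (hρσ : ρ < σ) {hi : ℚ} (hhi : ρ ≤ ((hi : ℚ) : ℝ)) :
    TorusEnergyUpperRow L U hi := by
  have hw0 : w ≠ 0 := by
    rintro rfl
    rw [dotProduct_zero, Complex.zero_re] at hwN
    exact hN.ne' hwN.symm
  have hK : K ≠ ⊥ := fun h => hw0 ((Submodule.mem_bot ℂ).1 (h ▸ hwK))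
  exact TorusEnergyUpperRow.of_block hKN hKH hK
    ((TempleKato.sector_enclosure_of_sums (LiebThm1.hamiltonian_isHermitian _ 1 U) K hKH hW hWK hwK hN
      hwN hρ hr2 hρσ).2.1.trans hhi)

/-- **Two-sided enclosure row from a pinned block**: `lo ≤ ρ − r²/(σ − ρ)` and `ρ ≤ hi` with the
Kato–Temple data in a pinned invariant block of `L²`-particle states give `TorusEnergyRow L U lo hi`.
[cite: Saad1992, Ch. III §3.2 Thm 3.8–3.9] [cite: LiebPRL1989, Theorem 2] -/
theorem TorusEnergyRow.of_blockPin_templeKato {U : ℝ} {K : Submodule ℂ (Fock (Orb (FermionTorus 2 L)))}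
    (hpin : TorusBlockPinRow L U K) (hKN : K ≤ nParticleSubmodule (L ^ 2))
    (hKH : ∀ v ∈ K, hamiltonian (fermionTorusGraph 2 L) 1 U *ᵥ v ∈ K)
    {W : Submodule ℂ (Fock (Orb (FermionTorus 2 L)))} {u : Fock (Orb (FermionTorus 2 L))} {σ : ℝ}
    (hW : ∀ z ∈ W, σ * (star z ⬝ᵥ z).re ≤ (star z ⬝ᵥ hamiltonian (fermionTorusGraph 2 L) 1 U *ᵥ z).re)
    (hWK : ∀ x ∈ K, ∃ z ∈ W, ∃ c : ℂ, x = z + c • u)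
    {w : Fock (Orb (FermionTorus 2 L))} (hwK : w ∈ K) {N ρ r2 : ℝ} (hN : 0 < N)
    (hwN : (star w ⬝ᵥ w).re = N)
    (hρ : (star w ⬝ᵥ hamiltonian (fermionTorusGraph 2 L) 1 U *ᵥ w).re = ρ * N)
    (hr2 : (star (hamiltonian (fermionTorusGraph 2 L) 1 U *ᵥ w) ⬝ᵥ
      hamiltonian (fermionTorusGraph 2 L) 1 U *ᵥ w).re ≤ (r2 + ρ ^ 2) * N)
    (hρσ : ρ < σ) {lo hi : ℚ} (hlo : ((lo : ℚ) : ℝ) ≤ ρ - r2 / (σ - ρ)) (hhi : ρ ≤ ((hi : ℚ) : ℝ)) :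
    TorusEnergyRow L U lo hi :=
  ⟨TorusEnergyLowerRow.of_blockPin_templeKato hpin hKH hW hWK hwK hN hwN hρ hr2 hρσ hlo,
    TorusEnergyUpperRow.of_block_templeKato hKN hKH hW hWK hwK hN hwN hρ hr2 hρσ hhi⟩

/-- **Central-sector blocks are `L²`-particle blocks** (bookkeeping for the hypotheses above). [folklore] -/
theorem le_nParticleSubmodule_of_le_szSector {K : Submodule ℂ (Fock (Orb (FermionTorus 2 L)))}
    (hKS : K ≤ szSector (Λ := FermionTorus 2 L) (L ^ 2) 0) : K ≤ nParticleSubmodule (L ^ 2) :=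
  hKS.trans inf_le_left

end M2
end Summit.Ventures.CertifiedManyBodySolver
end
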